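import Summits.BirchSwinnertonDyer.Rank1Residual.X12.CMRamifiedRecordBridge
import HarnessLib

/-!
# Leaf `CornerF ∧ p ramified in K` (K12r): certificate-record schema, PART F — the FULL-POPULATION
# regime record `N / T_cube / T_split / V` of a K12r@3 class (cell `bsd-print-cfram`, typer seat `ty3`;
# addendum to `X12/CMRamifiedRecordSchemaE.lean`, consumed by the displays `X12/CMRamifiedRegimePop*.lean`)

HONEST FRAMING (cell `bsd-print-cfram`, run/shared/lean/pub/bsd-print-cfram/, verbatim in every file
of the cell): PARTITION currency only — the leaf counts when its class theorem is in the kernel BY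
NAME, flag-free; Literature named facts are statement-only with cite tags, never sorried theorems;
every imported theorem carries its printed hypotheses verbatim; numbers, not adjectives. THIS FILE IS
DATA INFRASTRUCTURE (a computable record, a decidable recheck, soundness lemmas); nothing about any
elliptic curve is asserted, no named fact is introduced, nothing is booked, no mark moves (the leaf
K12r and its `p = 3` slice `Summit.BirchSwinnertonDyer.WAllCornerFRamifiedAtThree` stay OPEN; the
regime children N / T / V of crux C1 — route `PrintCFram`, items stmt-BirchSwinnertonDyer-20698 /
-20699 / -20700 — stay OPEN).

## What a `PopRow` records and what the kernel rechecks

The `p = 3` slice has 919 isogeny classes of conductor `N < 5·10⁵` (Cremona's range; p4 g2 census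
kit j284048 = REF S22 kit j284299: classes N 425 / T_cube 178 / T_split 296 / V 20, letters
class-invariant); PARTS B–E recorded the 98 window classes (`N < 2·10⁴`) `+ 309123c/d`. A `PopRow`
is the regime record of ONE class anywhere in the range: `W` = the `j = 0` member with the smaller
Cremona number `= E_k` (`k` sixth-power-free), its minimal model `ainvs` and `k`-scalings `u₁, u₂`
(`c₆·u₁⁶ = −864·k·u₂⁶`), conductor `cond` with factorisation, the Tamagawa list of the minimal model
(two engines: PARI `elllocalred` ‖ Sage `local_data`), `#W(ℚ)_tors`, `#W'(ℚ)_tors`, the letter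
`regime ∈ {0 = N, 1 = T, 2 = V}` (PART E's `regimeCode` = the closed-form T-bit on `k`, `−27k` + the
away bit; by `X12/CMRamifiedRecordBridge.lean` this IS «`W(ℚ₃)[3] ≠ 0 ∨ W^{(−3)}(ℚ₃)[3] ≠ 0`» resp. the
O11@3 binders, BY NAME, for any curve with Mordell model `y² = x³ + k`), the T sub-letter
`tSub ∈ {0, 1 = cube type, 2 = split type}` with CERTIFICATES — `sqW` with `sqW² = k ∨ sqW² = −3k`
for cube type (`k ∈ ℚ² ∨ −3k ∈ ℚ²` ⟺ `E_k` or `E_{−27k}` has a RATIONAL point of order `3` ⟺ the class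
of a cube-sum curve `x³ + y³ = n`, p4 `PrintCFram.exists_rational_three_torsion_pair_iff` /
`exists_isIsogenous_cubeSumCurve`, p548859), and a modulus `nrMod` to which the positive one of
`k, −3k` is a quadratic NON-residue for split type (so neither is a rational square) — `cSplit3 =
v₃(∏_{ℓ ≡ 1 (3)} c_ℓ)`, and the `window` bit (`cond < 2·10⁴`).
`PopRow.consistent` rechecks in the kernel: `factorsOK cond Nfactors`, `3² ∣ cond`, Tamagawa primes =
primes of `cond`, `c₄(ainvs) = 0 ≠ Δ(ainvs)`, the `k`-scaling identity, `k ≠ 0`, `regime = regimeCode k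
tam`, `cSplit3 = cSplit3Of tam`, `(regime = 1) = (tSub ≠ 0)`, `tSub ≤ 2`, the two certificates, and
`window = (cond < 20000)`. NOT rechecked (engines' work, two engines agreeing): that `ainvs` is
`W`'s minimal model and `cond` its conductor, the Tamagawa VALUES (hence the away/V bit's input), the
torsion orders. Soundness (§3): `tSub = 1 → IsSquare k ∨ IsSquare (−3k)` (over `ℚ`),
`tSub = 2 → ¬IsSquare k ∧ ¬IsSquare (−3k)` (so, with p4's `exists_rational_three_torsion_pair_iff`,
`tSub = 1 ⟺ E_k` or `E_{−27k}` has a rational point of order `3` — stated by name in the addendum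
`X12/CMRamifiedRecordSchemaFCube.lean`), and the PART F §1 bridge gives `regime ≠ 1 ⟺` both O11@3
binders for any `W` with `C • W = (y² = x³ + k)` (`PopRow.regime_ne_one_iff`).

References: `X12/CMRamifiedRecordSchema{C,E}.lean`, `X12/CMRamifiedRecordBridge.lean`,
`Theorems/PrintCFramTCubeSum.lean` (p4), p4 g2 REGIME-CENSUS-919.md (kit j284048), REFEREE.md S22.
-/

set_option autoImplicit false

namespace Summit.BirchSwinnertonDyer.Rank1Residual.X12.CMRamifiedRecords

open Summit.BirchSwinnertonDyer.BirchSwinnertonDyer.Rank1Residual.HeegnerIndexRecords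
open Summit.BirchSwinnertonDyer.Rank1Residual.X10.JetchevTamagawaRecords (c6)

/-! ### §1 Helpers: the rational-square certificates -/

/-- `z` is a quadratic NON-residue modulo `q ≥ 2`: no `x < q` has `x² ≡ z (mod q)`. [folklore] -/
def nonResidue (q : ℕ) (z : ℤ) : Bool :=
  decide (2 ≤ q) && (List.range q).all fun x => ((x : ℤ) * x - z) % (q : ℤ) != 0

/-- The member of `{k, −3k}` that can be a rational square: the positive one (`k ≠ 0`). [folklore] -/
def sqTarget (k : ℤ) : ℤ := if 0 < k then k else -3 * k

/-- A non-residue modulo some `q` is not the square of an integer. [folklore] -/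
theorem not_isSquare_int_of_nonResidue {q : ℕ} {z : ℤ} (h : nonResidue q z = true) :
    ¬ IsSquare z := by
  simp only [nonResidue, Bool.and_eq_true, decide_eq_true_eq, List.all_eq_true, bne_iff_ne,
    ne_eq] at h
  obtain ⟨hq, hall⟩ := h
  rintro ⟨s, rfl⟩
  have hq0 : (0 : ℤ) < (q : ℤ) := by exact_mod_cast (show 0 < q by omega)
  have hx0 : 0 ≤ s % (q : ℤ) := Int.emod_nonneg _ (ne_of_gt hq0)
  have hxq : s % (q : ℤ) < (q : ℤ) := Int.emod_lt_of_pos _ hq0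
  have hmem : (s % (q : ℤ)).toNat ∈ List.range q := by
    rw [List.mem_range]
    omega
  apply hall _ hmem
  rw [Int.toNat_of_nonneg hx0]
  have hmod : ((s % (q : ℤ)) * (s % (q : ℤ)) - s * s) % (q : ℤ) = 0 := by
    have h1 : (s % (q : ℤ)) * (s % (q : ℤ)) % (q : ℤ) = s * s % (q : ℤ) := by
      rw [Int.mul_emod, Int.emod_emod_of_dvd _ (dvd_refl _), ← Int.mul_emod]
    rw [Int.sub_emod, h1, ← Int.sub_emod, sub_self, Int.zero_emod]
  exact hmod

/-- … hence not the square of a rational (`Rat.isSquare_intCast_iff`). [folklore] -/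
theorem not_isSquare_rat_of_nonResidue {q : ℕ} {z : ℤ} (h : nonResidue q z = true) :
    ¬ IsSquare ((z : ℤ) : ℚ) := fun hs =>
  not_isSquare_int_of_nonResidue h (Rat.isSquare_intCast_iff.mp hs)

/-! ### §2 The record type and its in-kernel recheck -/

/-- **Full-population REGIME record of a K12r@3 class** (module docstring). `regime`: `0 = N`,
`1 = T`, `2 = V`; `tSub`: `0` (not T), `1 = T_cube` (`k ∈ ℚ²` or `−3k ∈ ℚ²`, certificate `sqW`),
`2 = T_split` (certificate `nrMod`). [folklore] -/
structure PopRow where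
  label : String
  cls : String
  cond : ℕ
  Nfactors : List (ℕ × ℕ)
  ainvs : List ℤ
  k : ℤ
  u1 : ℕ
  u2 : ℕ
  tam : List (ℕ × ℕ)
  tors : ℕ
  tors' : ℕ
  regime : ℕ
  tSub : ℕ
  sqW : ℕ
  nrMod : ℕ
  cSplit3 : ℕ
  window : Bool

namespace PopRow

/-- Block 1 (shape): five a-invariants, `cond` with its prime factorisation (trial division),
`3² ∣ cond` (additive at `3`), the Tamagawa list indexed by exactly the primes of `cond`, torsion
orders `≥ 1`, and the `window` bit `= (cond < 2·10⁴)`. [folklore] -/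
def shapeOK (r : PopRow) : Bool :=
  (r.ainvs.length == 5) && factorsOK r.cond r.Nfactors &&
  (r.Nfactors.any fun qe => qe.1 == 3 && decide (2 ≤ qe.2)) &&
  (r.tam.map Prod.fst == r.Nfactors.map Prod.fst) &&
  decide (1 ≤ r.tors) && decide (1 ≤ r.tors') && (r.window == decide (r.cond < 20000))

/-- Block 2 (`j = 0` model): `c₄ = 0`, `Δ ≠ 0`, `k ≠ 0`, and `c₆·u₁⁶ = −864·k·u₂⁶`
(`W ≅ E_k : y² = x³ + k` over `ℚ`). [folklore] -/
def modelOK (r : PopRow) : Bool :=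
  (c4 r.ainvs == 0) && (discr r.ainvs != 0) && (r.k != 0) && decide (1 ≤ r.u1) && decide (1 ≤ r.u2) &&
  (c6 r.ainvs * (r.u1 : ℤ) ^ 6 == -864 * r.k * (r.u2 : ℤ) ^ 6)

/-- Block 3 (regime): `regime = regimeCode k tam` (PART E) and `cSplit3 = cSplit3Of tam`. [folklore] -/
def regimeOK (r : PopRow) : Bool :=
  (r.regime == regimeCode r.k r.tam) && (r.cSplit3 == cSplit3Of r.tam)

/-- Block 4 (T sub-letter with certificates): `(regime = 1) = (tSub ≠ 0)`, `tSub ≤ 2`;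
`tSub = 1 →` `sqW² = k ∨ sqW² = −3k`; `tSub = 2 →` the positive one of `k, −3k` is a quadratic
non-residue modulo `nrMod`. [folklore] -/
def tSubOK (r : PopRow) : Bool :=
  ((r.regime == 1) == (r.tSub != 0)) && decide (r.tSub ≤ 2) &&
  (r.tSub != 1 || ((r.sqW : ℤ) * r.sqW == r.k || (r.sqW : ℤ) * r.sqW == -3 * r.k)) &&
  (r.tSub != 2 || nonResidue r.nrMod (sqTarget r.k))

/-- **The in-kernel recheck of a `PopRow`**: the four blocks. [folklore] -/
def consistent (r : PopRow) : Bool :=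
  r.shapeOK && r.modelOK && r.regimeOK && r.tSubOK

/-- `consistent` unpacked into its four blocks. [folklore] -/
theorem consistent_iff (r : PopRow) :
    r.consistent = true ↔
      r.shapeOK = true ∧ r.modelOK = true ∧ r.regimeOK = true ∧ r.tSubOK = true := by
  simp only [consistent, Bool.and_eq_true]
  tauto

/-- The fine letter `0 = N`, `1 = T_cube`, `2 = T_split`, `3 = V` of a record. [folklore] -/
def letter (r : PopRow) : ℕ :=
  if r.regime = 1 then (if r.tSub = 1 then 1 else 2) else (if r.regime = 0 then 0 else 3)

end PopRow

/-- The tally `(#N, #T_cube, #T_split, #V)` of a list of records (by `PopRow.letter`). [folklore] -/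
def popTally (rs : List PopRow) : ℕ × ℕ × ℕ × ℕ :=
  ((rs.filter fun r => r.letter == 0).length, (rs.filter fun r => r.letter == 1).length,
    (rs.filter fun r => r.letter == 2).length, (rs.filter fun r => r.letter == 3).length)

/-- What a display file checks by `decide`: every record consistent AND the tally as stated. [folklore] -/
def popCheck (rs : List PopRow) (t : ℕ × ℕ × ℕ × ℕ) : Bool :=
  rs.all PopRow.consistent && (popTally rs == t)

/-- Unpacking `popCheck`. [folklore] -/
theorem popCheck_iff (rs : List PopRow) (t : ℕ × ℕ × ℕ × ℕ) :
    popCheck rs t = true ↔ rs.all PopRow.consistent = true ∧ popTally rs = t := by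
  simp only [popCheck, Bool.and_eq_true, beq_iff_eq]

/-- Unpacking a display theorem per member. [folklore] -/
theorem PopRow.consistent_of_popCheck {rs : List PopRow} {t : ℕ × ℕ × ℕ × ℕ}
    (h : popCheck rs t = true) {r : PopRow} (hr : r ∈ rs) : r.consistent = true :=
  List.all_eq_true.1 ((popCheck_iff rs t).1 h).1 r hr

/-! ### §3 Soundness of a consistent record -/

namespace PopRow

/-- A consistent record has `k ≠ 0`, `regime = regimeCode k tam`. [folklore] -/
theorem k_ne_zero_of_consistent {r : PopRow} (h : r.consistent = true) :
    r.k ≠ 0 ∧ r.regime = regimeCode r.k r.tam := by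
  obtain ⟨-, hm, hr, -⟩ := (consistent_iff r).1 h
  simp only [modelOK, Bool.and_eq_true, bne_iff_ne, ne_eq] at hm
  simp only [regimeOK, Bool.and_eq_true, beq_iff_eq] at hr
  exact ⟨hm.1.1.1.2, hr.1⟩

/-- The T sub-letter block of a consistent record, unpacked. [folklore] -/
theorem tSub_spec_of_consistent {r : PopRow} (h : r.consistent = true) :
    (r.regime = 1 ↔ r.tSub ≠ 0) ∧ r.tSub ≤ 2 ∧
      (r.tSub = 1 → (r.sqW : ℤ) * r.sqW = r.k ∨ (r.sqW : ℤ) * r.sqW = -3 * r.k) ∧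
      (r.tSub = 2 → nonResidue r.nrMod (sqTarget r.k) = true) := by
  obtain ⟨-, -, -, ht⟩ := (consistent_iff r).1 h
  simp only [tSubOK, Bool.and_eq_true, Bool.or_eq_true, beq_iff_eq, decide_eq_true_eq, bne_iff_ne,
    ne_eq] at ht
  obtain ⟨⟨⟨h1, h2⟩, h3⟩, h4⟩ := ht
  refine ⟨?_, h2, fun ht1 => ?_, fun ht2 => ?_⟩
  · constructor
    · intro hr1
      have : (r.regime == 1) = true := beq_iff_eq.mpr hr1
      rw [h1] at this
      simpa using this
    · intro ht0
      have : (r.tSub != 0) = true := by simpa [bne_iff_ne] using ht0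
      rw [← h1] at this
      exact beq_iff_eq.mp this
  · rcases h3 with h3 | h3
    · exact absurd ht1 (by simpa [bne_iff_ne] using h3)
    · exact h3
  · rcases h4 with h4 | h4
    · exact absurd ht2 (by simpa [bne_iff_ne] using h4)
    · exact h4

/-- **Cube type is sound**: `tSub = 1 →` `k ∈ ℚ²` or `−3k ∈ ℚ²`. [folklore] -/
theorem isSquare_or_of_tSub_eq_one {r : PopRow} (h : r.consistent = true) (h1 : r.tSub = 1) :
    IsSquare ((r.k : ℤ) : ℚ) ∨ IsSquare (-3 * ((r.k : ℤ) : ℚ)) := by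
  rcases (tSub_spec_of_consistent h).2.2.1 h1 with hs | hs
  · exact Or.inl ⟨(r.sqW : ℚ), by exact_mod_cast hs.symm⟩
  · exact Or.inr ⟨(r.sqW : ℚ), by exact_mod_cast hs.symm⟩

/-- **Split type is sound**: `tSub = 2 →` neither `k` nor `−3k` is a rational square. [folklore] -/
theorem not_isSquare_of_tSub_eq_two {r : PopRow} (h : r.consistent = true) (h2 : r.tSub = 2) :
    ¬ IsSquare ((r.k : ℤ) : ℚ) ∧ ¬ IsSquare (-3 * ((r.k : ℤ) : ℚ)) := by
  have hk := (k_ne_zero_of_consistent h).1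
  have hc := (tSub_spec_of_consistent h).2.2.2 h2
  unfold sqTarget at hc
  -- a negative rational is not a square (cf. `GoldfeldGoodTwists.not_isSquare_of_neg`)
  have neg_not_sq : ∀ x : ℚ, x < 0 → ¬ IsSquare x := by
    rintro x hx ⟨s, hs⟩
    have : 0 ≤ s * s := mul_self_nonneg s
    linarith
  split_ifs at hc with hpos
  · refine ⟨not_isSquare_rat_of_nonResidue hc, neg_not_sq _ ?_⟩
    have : (0 : ℚ) < (r.k : ℚ) := by exact_mod_cast hpos
    linarith
  · have hneg : r.k < 0 := lt_of_le_of_ne (not_lt.mp hpos) hk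
    refine ⟨neg_not_sq _ (by exact_mod_cast hneg), ?_⟩
    have e : (-3 * ((r.k : ℤ) : ℚ)) = (((-3 * r.k : ℤ)) : ℚ) := by push_cast; ring
    rw [e]
    exact not_isSquare_rat_of_nonResidue hc


section Curves

open scoped Classical
open WeierstrassCurve Literature.NumberTheory.EllipticCurves

/-- **Regime ≠ T ⟺ both O11@3 binders** (PART F §1 bridge, p4 p546152 by name): for a consistent
record `r` and ANY `W` over `ℚ` with Mordell model `C • W = (y² = x³ + r.k)`, `r.regime ≠ 1` iff
`W(ℚ₃)[3] = 0` and `W^{(−3)}(ℚ₃)[3] = 0`. [cite: SilvermanAEC2009, Exercise 3.7] -/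
theorem regime_ne_one_iff {r : PopRow} (h : r.consistent = true) (W : WeierstrassCurve ℚ)
    {C : VariableChange ℚ} (hW : C • W = mordellCurve ((r.k : ℤ) : ℚ)) :
    r.regime ≠ 1 ↔
      ((∀ Q : (W.baseChange ℚ_[3]).toAffine.Point, (3 : ℕ) • Q = 0 → Q = 0) ∧
        (∀ Q : ((W.quadraticTwist (-3 : ℚ)).baseChange ℚ_[3]).toAffine.Point,
          (3 : ℕ) • Q = 0 → Q = 0)) := by
  obtain ⟨hk, hreg⟩ := k_ne_zero_of_consistent h
  rw [hreg, regimeCode_ne_one_iff, tBit_eq_false_iff_noThreeTorsion_pair W hk hW]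

/-- **Regime N ⟺ the O11@3 sub-leaf** (both binders and the away bit). [cite: SilvermanAEC2009, Exercise 3.7] -/
theorem regime_eq_zero_iff {r : PopRow} (h : r.consistent = true) (W : WeierstrassCurve ℚ)
    {C : VariableChange ℚ} (hW : C • W = mordellCurve ((r.k : ℤ) : ℚ)) :
    r.regime = 0 ↔
      (((∀ Q : (W.baseChange ℚ_[3]).toAffine.Point, (3 : ℕ) • Q = 0 → Q = 0) ∧
        (∀ Q : ((W.quadraticTwist (-3 : ℚ)).baseChange ℚ_[3]).toAffine.Point,
          (3 : ℕ) • Q = 0 → Q = 0)) ∧ awayOK r.tam = true) := by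
  obtain ⟨hk, hreg⟩ := k_ne_zero_of_consistent h
  rw [hreg, regimeCode_eq_zero_iff, tBit_eq_false_iff_noThreeTorsion_pair W hk hW]

/-- **Regime V** (both binders, away bit false). [cite: SilvermanAEC2009, Exercise 3.7] -/
theorem regime_eq_two_iff {r : PopRow} (h : r.consistent = true) (W : WeierstrassCurve ℚ)
    {C : VariableChange ℚ} (hW : C • W = mordellCurve ((r.k : ℤ) : ℚ)) :
    r.regime = 2 ↔
      (((∀ Q : (W.baseChange ℚ_[3]).toAffine.Point, (3 : ℕ) • Q = 0 → Q = 0) ∧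
        (∀ Q : ((W.quadraticTwist (-3 : ℚ)).baseChange ℚ_[3]).toAffine.Point,
          (3 : ℕ) • Q = 0 → Q = 0)) ∧ awayOK r.tam = false) := by
  obtain ⟨hk, hreg⟩ := k_ne_zero_of_consistent h
  rw [hreg, regimeCode_eq_two_iff, tBit_eq_false_iff_noThreeTorsion_pair W hk hW]

/-- **Regime T ⟺ a `ℚ₃`-point of order `3` on `W` or on `W^{(−3)}`**. [cite: SilvermanAEC2009, Exercise 3.7] -/
theorem regime_eq_one_iff {r : PopRow} (h : r.consistent = true) (W : WeierstrassCurve ℚ)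
    {C : VariableChange ℚ} (hW : C • W = mordellCurve ((r.k : ℤ) : ℚ)) :
    r.regime = 1 ↔
      ((∃ Q : (W.baseChange ℚ_[3]).toAffine.Point, Q ≠ 0 ∧ (3 : ℕ) • Q = 0) ∨
        (∃ Q : ((W.quadraticTwist (-3 : ℚ)).baseChange ℚ_[3]).toAffine.Point,
          Q ≠ 0 ∧ (3 : ℕ) • Q = 0)) := by
  obtain ⟨hk, hreg⟩ := k_ne_zero_of_consistent h
  rw [hreg, regimeCode_eq_one_iff, tBit_eq_true_iff_exists_threeTorsion W hk hW]

end Curves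

end PopRow

end Summit.BirchSwinnertonDyer.Rank1Residual.X12.CMRamifiedRecords
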